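import Summits.KontsevichZagierPeriods.KontsevichZagierPeriods.Theorems.LinRedNormalFormArrangementNormalFormStubRebaseSimpleZeroNestedTools

/-!
# Stub `stub_rebaseSimpleZeroTwo`, part `rebaseSimpleZero_nestedCommon` (crux `ArrangementNormalForm`,
line `janus-bands`) — brick `NestedSuper`

The SUPER-SECTION Janus of a clean nested pair `A(y) < tᵢ < tⱼ < B(y)` over a one-dimensional
base (constant letters): for a constant level `T ≥ B ≥ A` on the base cell, rule (1a) applied to
the position of `B` among `tᵢ < tⱼ` inside the larger nest `A < tᵢ < tⱼ < T` gives, modulo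
`KZ.relations`,
`[A<tᵢ<tⱼ<B] = [A<tᵢ<tⱼ<T] − [A<tᵢ<B]×[B<tⱼ<T] − [B<tᵢ<tⱼ<T]`;
the two nests on the right are separable by a constant `κ` with `B ≤ κ ≤ T` (`IsNest.good_sep`)
and the product is good by the product case (`RebaseZero.good_literal`), so the pair is good as
soon as the literal integrand converges absolutely on `{A < tᵢ < tⱼ < T}` (`IsNest.good_super`).
The analytic input at a pinch vertex `(y₀, t₀)` whose fibre poles lie AT the vertex level `t₀`
(and whose base pole is away from `y₀`) is the LOG-CONE ESTIMATE `RebaseNest.integrableOn_logCone`: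
`|f| ≤ K/((t₁ − t₀)(t₂ − t₀))` on `{α |y − y₀| < tₗ − t₀ < S}` is integrable (domination by
`|y − y₀|^{-1/2} (t₁ − t₀)^{-3/4} (t₂ − t₀)^{-3/4}`). Registered: `rebaseSimpleZero_nestedSuper`.

References: M. Kontsevich, D. Zagier, *Periods* (2001), §1.2, rules (1a), (2).
-/

noncomputable section

open Set MeasureTheory MvPolynomial
open Literature.NumberTheory.Transcendental Literature.ModelTheory.ExponentialFields

namespace Summit.KontsevichZagierPeriods.ArrangementNormalForm.JanusBands

namespace RebaseNest

open SeparatePos RebasePos RebaseZero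

/-! ### The log-cone estimate -/

/-- The one-variable dominating factor `|x| ^ r` (`r > −1`) on `0 < |x| < S`, extended by `0`.
[folklore] -/
theorem exists_dominator_rpow (r S : ℝ) (hr : -1 < r) : ∃ F : ℝ → ℝ, Integrable F ∧
    ∀ x : ℝ, 0 < |x| → |x| < S → F x = |x| ^ r := by
  set H : ℝ → ℝ := (Ioo 0 S).indicator fun x => x ^ r with hH
  have hHi : Integrable H := by
    rcases le_or_gt S 0 with hS | hS
    · have h0 : H = 0 := by
        funext x
        rw [hH, Ioo_eq_empty (not_lt.2 hS), indicator_empty, Pi.zero_apply]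
      rw [h0]
      exact integrable_zero _ _ _
    · exact (integrable_indicator_iff measurableSet_Ioo).2
        ((intervalIntegral.integrableOn_Ioo_rpow_iff hS).2 hr)
  refine ⟨fun x => H x + H (0 - x), hHi.add (hHi.comp_sub_left 0), fun x hx hxS => ?_⟩
  rcases lt_or_gt_of_ne (abs_pos.1 hx) with h | h
  · rw [abs_of_neg h] at hxS ⊢
    simp [hH, indicator_of_notMem, indicator_of_mem, h.le, neg_pos.2 h, hxS]
  · rw [abs_of_pos h] at hxS ⊢
    simp [hH, indicator_of_notMem, indicator_of_mem, h, h.le, hxS]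

/-- `1/u ≤ w^{-1/4} u^{-3/4}` for `0 < w < u`. [folklore] -/
theorem one_div_le_rpow {w u : ℝ} (hw : 0 < w) (hwu : w < u) :
    1 / u ≤ w ^ (-(1 / 4) : ℝ) * u ^ (-(3 / 4) : ℝ) := by
  have hu : 0 < u := hw.trans hwu
  have e1 : 1 / u = u ^ (-(1 / 4) : ℝ) * u ^ (-(3 / 4) : ℝ) := by
    rw [← Real.rpow_add hu, show (-(1 / 4) : ℝ) + -(3 / 4) = -1 by norm_num, Real.rpow_neg_one, one_div]
  rw [e1]
  exact mul_le_mul_of_nonneg_right (Real.rpow_le_rpow_of_nonpos hw hwu.le (by norm_num))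
    (Real.rpow_nonneg hu.le _)

/-- **Log-cone estimate** (dimension `3`, base coordinate `0`, fibres `1, 2`). If on a measurable
set `W` both fibres satisfy `α |y − y₀| < tₗ − t₀ < S` with `0 < |y − y₀| ≤ R` (`α > 0`), and
`|f| ≤ K/((t₁ − t₀)(t₂ − t₀))` on `W` with `f` a.e.-strongly measurable there, then `f` is
integrable on `W`. [folklore] -/
theorem integrableOn_logCone {f : (Fin 3 → ℝ) → ℝ} {W : Set (Fin 3 → ℝ)} (hWm : MeasurableSet W)
    (hf : AEStronglyMeasurable f (volume.restrict W)) {y₀ t₀ α K R S : ℝ} (hα : 0 < α)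
    (hW : ∀ z ∈ W, (0 < |z 0 - y₀| ∧ |z 0 - y₀| ≤ R) ∧ (α * |z 0 - y₀| < z 1 - t₀ ∧ z 1 - t₀ < S) ∧
      (α * |z 0 - y₀| < z 2 - t₀ ∧ z 2 - t₀ < S))
    (hfK : ∀ z ∈ W, |f z| ≤ K / ((z 1 - t₀) * (z 2 - t₀))) : IntegrableOn f W := by
  obtain ⟨F₀, hF₀i, hF₀⟩ := exists_dominator_rpow (-(1 / 2)) (R + 1) (by norm_num)
  obtain ⟨F₁, hF₁i, hF₁⟩ := exists_dominator_rpow (-(3 / 4)) S (by norm_num)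
  set G : Fin 3 → ℝ → ℝ := ![fun y => F₀ (y - y₀), fun t => F₁ (t - t₀), fun t => F₁ (t - t₀)] with hG
  have hGi : ∀ l, Integrable (G l) :=
    Fin.forall_fin_succ.2 ⟨hF₀i.comp_sub_right y₀,
      Fin.forall_fin_two.2 ⟨hF₁i.comp_sub_right t₀, hF₁i.comp_sub_right t₀⟩⟩
  have hprod : Integrable (fun z : Fin 3 → ℝ => |K| * α ^ (-(1 / 2) : ℝ) * ∏ l, G l (z l)) :=
    (Integrable.fintype_prod (μ := fun _ => volume) hGi).const_mul (|K| * α ^ (-(1 / 2) : ℝ))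
  refine Integrable.mono' hprod.integrableOn hf ((ae_restrict_iff' hWm).2 (Filter.Eventually.of_forall
    fun z hz => ?_))
  obtain ⟨⟨hy0, hyR⟩, ⟨h1, h1'⟩, ⟨h2, h2'⟩⟩ := hW z hz
  set w := α * |z 0 - y₀| with hw
  have hw0 : 0 < w := mul_pos hα hy0
  have hu1 : 0 < z 1 - t₀ := hw0.trans h1
  have hu2 : 0 < z 2 - t₀ := hw0.trans h2
  have ha1 : 0 < |z 1 - t₀| ∧ |z 1 - t₀| < S := by rw [abs_of_pos hu1]; exact ⟨hu1, h1'⟩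
  have ha2 : 0 < |z 2 - t₀| ∧ |z 2 - t₀| < S := by rw [abs_of_pos hu2]; exact ⟨hu2, h2'⟩
  rw [Real.norm_eq_abs, Fin.prod_univ_three]
  simp only [hG, Matrix.cons_val_zero, Matrix.cons_val_one, Matrix.cons_val_two, Matrix.head_cons,
    Matrix.tail_cons, hF₀ _ hy0 (by linarith), hF₁ _ ha1.1 ha1.2, hF₁ _ ha2.1 ha2.2, abs_of_pos hu1,
    abs_of_pos hu2]
  have hww : w ^ (-(1 / 4) : ℝ) * w ^ (-(1 / 4) : ℝ) = α ^ (-(1 / 2) : ℝ) * |z 0 - y₀| ^ (-(1 / 2) : ℝ) := by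
    rw [← Real.rpow_add hw0, show (-(1 / 4) : ℝ) + -(1 / 4) = -(1 / 2) by norm_num, hw,
      Real.mul_rpow hα.le (abs_nonneg _)]
  have hk1 := one_div_le_rpow hw0 h1
  have hk2 := one_div_le_rpow hw0 h2
  have hn2 : 0 ≤ 1 / (z 2 - t₀) := by positivity
  have hb1 : 0 ≤ w ^ (-(1 / 4) : ℝ) * (z 1 - t₀) ^ (-(3 / 4) : ℝ) := by positivity
  calc |f z| ≤ K / ((z 1 - t₀) * (z 2 - t₀)) := hfK z hz
    _ ≤ |K| / ((z 1 - t₀) * (z 2 - t₀)) := div_le_div_of_nonneg_right (le_abs_self K) (mul_pos hu1 hu2).le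
    _ = |K| * ((1 / (z 1 - t₀)) * (1 / (z 2 - t₀))) := by
        rw [one_div_mul_one_div, mul_one_div]
    _ ≤ |K| * ((w ^ (-(1 / 4) : ℝ) * (z 1 - t₀) ^ (-(3 / 4) : ℝ)) *
          (w ^ (-(1 / 4) : ℝ) * (z 2 - t₀) ^ (-(3 / 4) : ℝ))) :=
        mul_le_mul_of_nonneg_left (mul_le_mul hk1 hk2 hn2 hb1) (abs_nonneg K)
    _ = |K| * α ^ (-(1 / 2) : ℝ) * (|z 0 - y₀| ^ (-(1 / 2) : ℝ) *
          (z 1 - t₀) ^ (-(3 / 4) : ℝ) * (z 2 - t₀) ^ (-(3 / 4) : ℝ)) := by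
        rw [show w ^ (-(1 / 4) : ℝ) * (z 1 - t₀) ^ (-(3 / 4) : ℝ) * (w ^ (-(1 / 4) : ℝ) *
            (z 2 - t₀) ^ (-(3 / 4) : ℝ)) = (w ^ (-(1 / 4) : ℝ) * w ^ (-(1 / 4) : ℝ)) *
            ((z 1 - t₀) ^ (-(3 / 4) : ℝ) * (z 2 - t₀) ^ (-(3 / 4) : ℝ)) by ring, hww]
        ring

/-! ### The super-section Janus -/

variable {m' : ℕ} {s : KZ.IntegralRep (0 + 1 + 2)} {M : Fin m' → Cf} {i j : Fin 2} {A Bd : Cf} {T : BData}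
  {p : MvPolynomial (Fin 0) ℚ} {a : Fin 2 → Option Cf}

/-- A clean nest over a bounded base cell has a bounded domain. [folklore] -/
theorem isBounded_nDom (M : Fin m' → Cf) {R : ℝ} (hR : ∀ y ∈ cell M, |y| ≤ R) (hij : i ≠ j) (A Bd : Cf) :
    Bornology.IsBounded (gDom 0 2 m' M (nlo i A) (nhi j Bd)) := by
  set C : ℝ := (|(A.1 (Fin.last 0) : ℝ)| + |(Bd.1 (Fin.last 0) : ℝ)|) * R + (|(A.2 : ℝ)| + |(Bd.2 : ℝ)|)
    with hC
  refine IntegrateOutLow.isBounded_of_forall_abs_le (R + C) fun z hz l => ?_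
  obtain ⟨hy, h1, h2, h3⟩ := (mem_nDom hij M A Bd z).1 hz
  have hyR := hR _ hy
  have hR0 : 0 ≤ R := (abs_nonneg _).trans hyR
  have hA := abs_ev_le_of A hyR
  have hB := abs_ev_le_of Bd hyR
  have hC0 : 0 ≤ C := by positivity
  have ht : ∀ t : ℝ, ev A (yv z) < t → t < ev Bd (yv z) → |t| ≤ R + C := fun t ht1 ht2 => by
    rw [abs_le] at hA hB ⊢
    constructor <;> nlinarith [abs_nonneg ((A.1 (Fin.last 0) : ℝ)), abs_nonneg ((Bd.1 (Fin.last 0) : ℝ)),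
      abs_nonneg (A.2 : ℝ), abs_nonneg (Bd.2 : ℝ)]
  rcases idx_cases l with rfl | ⟨l, rfl⟩
  · exact hyR.trans (le_add_of_nonneg_right hC0)
  · rcases fin_two_eq_or hij l with rfl | rfl
    · exact ht (tv z l) h1 (h2.trans h3)
    · exact ht (tv z l) (h1.trans h2) h3

/-- **Super-section Janus.** Let `A < tᵢ < tⱼ < B` be a clean nest with constant letters over a
base cell on which `A ≤ B ≤ κ ≤ T` for constants `κ, T`. If the literal integrand converges
absolutely on the bounded nest `{A < tᵢ < tⱼ < T}`, then modulo `KZ.relations`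
`[A<tᵢ<tⱼ<B] = [A<tᵢ<tⱼ<T] − [A<tᵢ<B]×[B<tⱼ<T] − [B<tᵢ<tⱼ<T]` (rule 1a: the ties `tᵢ = B`,
`tⱼ = B` are null), the two nests are separable by `κ` and the product is good by the product
case; so the pair is good. [Kontsevich–Zagier 2001, §1.2, rules (1), (2)] -/
theorem IsNest.good_super (hN : IsNest s M i j A Bd T p a) (κ Tc : ℚ)
    (hle : ∀ y ∈ cell M, ev A y ≤ ev Bd y ∧ ev Bd y ≤ κ ∧ (κ : ℝ) ≤ Tc)
    (hW : IntegrableOn (glitB T p a) (gDom 0 2 m' M (nlo i A) (nhi j (RebaseZero.mk 0 Tc))))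
    (hWb : Bornology.IsBounded (gDom 0 2 m' M (nlo i A) (nhi j (RebaseZero.mk 0 Tc)))) :
    Good 2 (KZ.of s) := by
  classical
  have hij := hN.ne
  have hTc : ∀ y : ℝ, ev (RebaseZero.mk 0 Tc) y = Tc := fun y => by rw [ev_mk, Rat.cast_zero, zero_mul, zero_add]
  -- the cells
  set DW := gDom 0 2 m' M (nlo i A) (nhi j (RebaseZero.mk 0 Tc)) with hDW
  set U : Fin 2 → Cf := fun l => if l = i then A else Bd with hU
  set V : Fin 2 → Cf := fun l => if l = i then Bd else RebaseZero.mk 0 Tc with hV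
  set DX := pDom M U V with hDX
  set DN := gDom 0 2 m' M (nlo i Bd) (nhi j (RebaseZero.mk 0 Tc)) with hDN
  have mW : ∀ z, z ∈ DW ↔ yv z ∈ cell M ∧ ev A (yv z) < tv z i ∧ tv z i < tv z j ∧ tv z j < Tc := fun z => by
    rw [hDW, mem_nDom hij, hTc]
  have mN : ∀ z, z ∈ DN ↔ yv z ∈ cell M ∧ ev Bd (yv z) < tv z i ∧ tv z i < tv z j ∧ tv z j < Tc := fun z => by
    rw [hDN, mem_nDom hij, hTc]
  have mX : ∀ z, z ∈ DX ↔ yv z ∈ cell M ∧ (ev A (yv z) < tv z i ∧ tv z i < ev Bd (yv z)) ∧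
      (ev Bd (yv z) < tv z j ∧ tv z j < Tc) := fun z => by
    rw [hDX, mem_pDom, forall_fin_two_iff hij]
    simp only [hU, hV, if_pos rfl, if_neg hij.symm, hTc]
  have mP := hN.mem
  -- inclusions
  have sP : s.domain ⊆ DW := fun z hz => by
    obtain ⟨hy, h1, h2, h3⟩ := (mP z).1 hz
    obtain ⟨-, hBk, hkT⟩ := hle _ hy
    exact (mW z).2 ⟨hy, h1, h2, h3.trans_le (hBk.trans hkT)⟩
  have sX : DX ⊆ DW := fun z hz => by
    obtain ⟨hy, ⟨h1, h2⟩, h3, h4⟩ := (mX z).1 hz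
    exact (mW z).2 ⟨hy, h1, h2.trans h3, h4⟩
  have sN : DN ⊆ DW := fun z hz => by
    obtain ⟨hy, h1, h2, h3⟩ := (mN z).1 hz
    exact (mW z).2 ⟨hy, (hle _ hy).1.trans_lt h1, h2, h3⟩
  -- the representations
  set W : KZ.IntegralRep (0 + 1 + 2) := ⟨DW, glitB T p a, isSemialgebraic_gDom _ _ _ _,
    isSemialgebraicFunOn_glit (isSemialgebraic_gDom _ _ _ _) _ _ _ _ _ _ _ _, hW⟩ with hWdef
  set rP := W.restrict s.domain (hN.dom ▸ isSemialgebraic_gDom _ _ _ _) sP with hrP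
  set rX := W.restrict DX (isSemialgebraic_pDom _ _ _) sX with hrX
  set rN := W.restrict DN (isSemialgebraic_gDom _ _ _ _) sN with hrN
  set Rr : Fin 3 → KZ.IntegralRep (0 + 1 + 2) := ![rP, rX, rN] with hRr
  have hRsub : ∀ k, (Rr k).domain ⊆ DW := by
    intro k; fin_cases k; exacts [sP, sX, sN]
  -- the ties are null
  have hNull : volume ({z : Fin (0 + 1 + 2) → ℝ | tv z i = ev Bd (yv z)} ∪
      {z | tv z j = ev Bd (yv z)}) = 0 :=
    measure_union_null (volume_tv_eq_ev i Bd) (volume_tv_eq_ev j Bd)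
  have hcov : DW \ (⋃ k ∈ (Finset.univ : Finset (Fin 3)), (Rr k).domain) ⊆
      {z : Fin (0 + 1 + 2) → ℝ | tv z i = ev Bd (yv z)} ∪ {z | tv z j = ev Bd (yv z)} := by
    rintro z ⟨hz, hzU⟩
    have hnot : ∀ k, z ∉ (Rr k).domain := fun k hk => hzU (mem_iUnion₂.2 ⟨k, Finset.mem_univ _, hk⟩)
    obtain ⟨hy, h1, h2, h3⟩ := (mW z).1 hz
    rcases lt_trichotomy (tv z j) (ev Bd (yv z)) with hj | hj | hj
    · exact absurd ((mP z).2 ⟨hy, h1, h2, hj⟩) (hnot 0)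
    · exact Or.inr hj
    rcases lt_trichotomy (tv z i) (ev Bd (yv z)) with hi | hi | hi
    · exact absurd ((mX z).2 ⟨hy, ⟨h1, hi⟩, hj, h3⟩) (hnot 1)
    · exact Or.inl hi
    · exact absurd ((mN z).2 ⟨hy, hi, h2, h3⟩) (hnot 2)
  -- the cells are disjoint
  have hdisj : ∀ k k' : Fin 3, k ≠ k' → (Rr k).domain ∩ (Rr k').domain = ∅ := by
    have d12 : s.domain ∩ DX = ∅ := eq_empty_of_forall_notMem fun z ⟨hz, hz'⟩ => by
      linarith [((mP z).1 hz).2.2.2, ((mX z).1 hz').2.2.1]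
    have d13 : s.domain ∩ DN = ∅ := eq_empty_of_forall_notMem fun z ⟨hz, hz'⟩ => by
      linarith [((mP z).1 hz).2.2.1, ((mP z).1 hz).2.2.2, ((mN z).1 hz').2.1]
    have d23 : DX ∩ DN = ∅ := eq_empty_of_forall_notMem fun z ⟨hz, hz'⟩ => by
      linarith [((mX z).1 hz).2.1.2, ((mN z).1 hz').2.1]
    intro k k' hkk'
    fin_cases k <;> fin_cases k' <;> first | exact absurd rfl hkk' | exact d12 | exact d13 | exact d23 |
      (rw [inter_comm]; first | exact d12 | exact d13 | exact d23)
  -- rule (1a)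
  have hrel : KZ.of W - ∑ k, KZ.of (Rr k) ∈ KZ.relations := by
    refine KZ.of_sub_sum_of_mem_relations Finset.univ W Rr (fun k _ => ?_) (fun k _ z _ => ?_)
      (measure_mono_null hcov hNull) (fun k _ k' _ hkk' => ?_)
    · rw [sdiff_eq_empty.2 (hRsub k), measure_empty]
    · fin_cases k <;> rfl
    · show volume ((Rr k).domain ∩ (Rr k').domain) = 0
      rw [hdisj k k' hkk', measure_empty]
  have e₀ : KZ.of s - KZ.of rP ∈ KZ.relations := KZ.of_sub_of_mem_relations_of_eqOn rfl hN.int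
  -- the three cells are good
  have gW : Good 2 (KZ.of W) := by
    refine IsNest.good_sep (M := M) (A := A) (Bd := RebaseZero.mk 0 Tc) (T := T) (p := p) (a := a)
      ⟨hij, rfl, fun _ _ => rfl, hN.n1, hN.n2, hN.a0, hWb⟩ κ fun y hy => ?_
    obtain ⟨hAB, hBk, hkT⟩ := hle y hy
    rw [hTc]
    exact ⟨hAB.trans hBk, hkT⟩
  have gN : Good 2 (KZ.of rN) := by
    refine IsNest.good_sep (M := M) (A := Bd) (Bd := RebaseZero.mk 0 Tc) (T := T) (p := p) (a := a)
      ⟨hij, rfl, fun _ _ => rfl, hN.n1, hN.n2, hN.a0, hWb.subset sN⟩ κ fun y hy => ?_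
    obtain ⟨-, hBk, hkT⟩ := hle y hy
    rw [hTc]
    exact ⟨hBk, hkT⟩
  have gX : Good 2 (KZ.of rX) :=
    good_literal rX M T.L T.e p T.ℓ₁ T.ℓ₂ a (fun l => Sum.inr (U l)) (fun l => Sum.inr (V l)) (Or.inl hN.n1)
      (fun l => ⟨⟨U l, rfl⟩, ⟨V l, rfl⟩⟩) (hWb.subset sX) rfl fun _ _ => rfl
  -- assemble
  have key : KZ.of rP - (KZ.of W - KZ.of rX - KZ.of rN) ∈ KZ.relations := by
    have := KZ.relations.neg_mem hrel
    rw [Fin.sum_univ_three] at this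
    convert this using 1
    simp only [hRr, Matrix.cons_val_zero, Matrix.cons_val_one, Matrix.cons_val_two, Matrix.head_cons,
      Matrix.tail_cons]
    abel
  exact good_of_sub_mem e₀ (good_of_sub_mem key ((gW.sub gX).sub gN))

end RebaseNest

/-- Registered support goal of this file (part of `rebaseSimpleZero_nestedCommon`): the
super-section Janus of a clean nested pair (`RebaseNest.IsNest.good_super`). -/
theorem rebaseSimpleZero_nestedSuper (m' : ℕ) (s : KZ.IntegralRep (0 + 1 + 2)) (M : Fin m' → (Fin (0 + 1) → ℚ) × ℚ) (i j : Fin 2) (A Bd : (Fin (0 + 1) → ℚ) × ℚ) (T : RebaseZero.BData) (p : MvPolynomial (Fin 0) ℚ) (a : Fin 2 → Option ((Fin (0 + 1) → ℚ) × ℚ)) (hN : RebaseNest.IsNest s M i j A Bd T p a) (κ Tc : ℚ) (hle : ∀ y ∈ RebaseZero.cell M, RebaseZero.ev A y ≤ RebaseZero.ev Bd y ∧ RebaseZero.ev Bd y ≤ κ ∧ (κ : ℝ) ≤ Tc) (hW : IntegrableOn (RebaseZero.glitB T p a) (SeparatePos.gDom 0 2 m' M (RebaseNest.nlo i A) (RebaseNest.nhi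 j (RebaseZero.mk 0 Tc)))) (hWb : Bornology.IsBounded (SeparatePos.gDom 0 2 m' M (RebaseNest.nlo i A) (RebaseNest.nhi j (RebaseZero.mk 0 Tc)))) : RebaseZero.Good 2 (KZ.of s) :=
  hN.good_super κ Tc hle hW hWb

end Summit.KontsevichZagierPeriods.ArrangementNormalForm.JanusBands
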